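import Summits.BirchSwinnertonDyer.BirchSwinnertonDyer.Theorems.ManinLocalTwoThreeShimuraIndexPlusIndex
import Literature.NumberTheory.EllipticCurves.ModularCurve
import Literature.NumberTheory.EllipticCurves.NewformsRealCoefficients
import HarnessLib

/-!
# Complex conjugation acts trivially on `Λ₀(f)/Λ₁(f)`; the index-`p²` configuration `Λ₁(f) = pΛ₀(f)` is impossible for `p ≥ 3`

Summit `BirchSwinnertonDyer`, route `ManinLocalTwoThree` (cell bsd-f2-manin), cruxes C2 `ManinOddAtFour` (stmt-BirchSwinnertonDyer-22967) and
C3 `ManinPrimeToThreeAtNine` (stmt-BirchSwinnertonDyer-22968); lead p1 gen 14.  Route-independent module (no `Theses` import).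

THE INPUT (already in the tree, p2 gen 9, `…ShimuraIndexPlusIndex.conj_sub_self_mem_periodLatticeGamma1`, E-es-70 Φ′): for `f ∈ S₂(Γ₀(N))`
with real Fourier coefficients, **complex conjugation acts trivially on `Λ₀(f)/Λ₁(f)`** — `z̄ − z ∈ Λ₁(f)` for every `z ∈ Λ₀(f)`
(`conj {∞, γ∞}_f = {∞, γ'∞}_f` with `γ' = (a, −b; −c, d)` of the same `d mod N`; arithmetic shadow: the kernel of `E₁ → E₀` is a CONSTANT
group scheme, Cartier dual to `E₀ ∩ Σ(N)` with `Σ(N)` the μ-type Shimura subgroup).  Nobody had drawn the consequence for the index-`p²`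
configurations of the Γ₀/Γ₁ ledger.  For a lattice-optimal `X₀(N)`-datum `D₀` (`Λ_{E₀} = c₀Λ₀(f)`), at EVERY level `N`:

* `false_of_conj_sub_self_mem_natCast_mul` — lattice geometry: on a rank-`2` lattice `Λ ⊂ ℂ`, `z̄ − z ∈ pΛ` for all `z ∈ Λ` is impossible for
  an integer `p ≥ 3` (the `ℝ`-linear map `z ↦ z̄ − z` has trace `−2`, which would be divisible by `p`; done in coordinates);
* `not_periodLatticeGamma1_eq_natCast_mul_periodLattice` / `not_periodLatticeGamma1_eq_three_mul_periodLattice` — **the index-`p²`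
  configuration `Λ₁(f) = pΛ₀(f)` NEVER occurs for `p ≥ 3`; in particular `Λ₁(f) ≠ 3Λ₀(f)`** — the index-`9` exclusion that
  `…ManinOfStevensConjectures.maninPrimeToThreeAtNine_of_stevensConjectures` took as a hypothesis and that the tree knew only at `N = 9q`
  (`not_periodLatticeGamma1_eq_three_mul_of_nine_mul`) is a THEOREM at every level;
* `re_mem_and_im_mul_I_mem_of_periodLatticeGamma1_eq_two_mul` — **at `p = 2` the index-`4` configuration `Λ₁(f) = 2Λ₀(f)` forces the Néron
  lattice `Λ_{E₀}` to be RECTANGULAR** (`re z, i·im z ∈ Λ_{E₀}` for all `z ∈ Λ_{E₀}`; i.e. `E₀(ℝ)` has two components, all of `E₀[2]` is real):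
  E-an-152b `ShimuraIndexNeFourAtFour` holds for every optimal curve with a non-rectangular (negative-discriminant) period lattice.

HONEST FRAMING: unconditional theorems about the tree's period lattices; they do NOT prove Manin's conjecture, C2, C3 or BSD (all OPEN): at
`p = 3` they remove the index-`9` branch (C3 ⟸ F-need ∧ Stevens I ∧ Stevens II, see `…IndexNineExcluded`), at `p = 2` only its
non-rectangular half.  No definitions, no named facts, no sorry.
[cite: Manin1972, §1.6] [cite: Stevens1989, §2]
-/

set_option autoImplicit false
-- the summit-side namespace `Summit.BirchSwinnertonDyer.BirchSwinnertonDyer.…` is the tree's (summit = sub-problem)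
set_option linter.dupNamespace false

noncomputable section

open scoped Classical ComplexConjugate MatrixGroups
open WeierstrassCurve Literature.NumberTheory.EllipticCurves Literature.NumberTheory.EllipticCurves.ModularForms
open CongruenceSubgroup

namespace Summit.BirchSwinnertonDyer.BirchSwinnertonDyer.Theorems.ManinLocalTwoThree

/-! ## §1 Lattice geometry: `z̄ − z ∈ pΛ` on a rank-`2` lattice -/

/-- **On a rank-`2` lattice `Λ = ℤω₁ ⊕ ℤω₂ ⊂ ℂ`, `z̄ − z ∈ pΛ` for all `z ∈ Λ` is impossible when `p ≥ 3`.**  In coordinates: writing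
`ω̄ᵢ − ωᵢ = p(·)` and applying conjugation once more (`conj(z̄ − z) = −(z̄ − z)`) gives integer relations `pa(pa + 2) = 0`, `pb(p(a+d) + 2) = 0`,
…, whose only solution for `p ∤ 2` is `a = b = c = d = 0`, i.e. `ω₁, ω₂ ∈ ℝ` — contradicting `ℝ`-independence. [folklore] -/
theorem false_of_conj_sub_self_mem_natCast_mul (L : PeriodPair) {p : ℕ} (hp : 3 ≤ p)
    (h : ∀ z ∈ L.lattice, ∃ y ∈ L.lattice, conj z - z = (p : ℂ) * y) : False := by
  obtain ⟨y₁, hy₁, h₁⟩ := h L.ω₁ L.ω₁_mem_lattice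
  obtain ⟨y₂, hy₂, h₂⟩ := h L.ω₂ L.ω₂_mem_lattice
  obtain ⟨a, b, rfl⟩ := PeriodPair.mem_lattice.mp hy₁
  obtain ⟨c, d, rfl⟩ := PeriodPair.mem_lattice.mp hy₂
  have e₁ : conj L.ω₁ = L.ω₁ + (p : ℂ) * (a * L.ω₁ + b * L.ω₂) := by rw [← h₁]; ring
  have e₂ : conj L.ω₂ = L.ω₂ + (p : ℂ) * (c * L.ω₁ + d * L.ω₂) := by rw [← h₂]; ring
  -- conjugate `e₁`, `e₂`
  have c₁ : L.ω₁ = conj L.ω₁ + (p : ℂ) * (a * conj L.ω₁ + b * conj L.ω₂) := by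
    have := congrArg conj e₁
    simpa only [Complex.conj_conj, map_add, map_mul, map_natCast, map_intCast] using this
  have c₂ : L.ω₂ = conj L.ω₂ + (p : ℂ) * (c * conj L.ω₁ + d * conj L.ω₂) := by
    have := congrArg conj e₂
    simpa only [Complex.conj_conj, map_add, map_mul, map_natCast, map_intCast] using this
  rw [e₁, e₂] at c₁ c₂
  -- the two real-linear relations between `ω₁`, `ω₂`
  set s₁ : ℤ := 2 * p * a + p ^ 2 * a ^ 2 + p ^ 2 * b * c with hs₁
  set t₁ : ℤ := 2 * p * b + p ^ 2 * a * b + p ^ 2 * b * d with ht₁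
  set s₂ : ℤ := 2 * p * c + p ^ 2 * a * c + p ^ 2 * c * d with hs₂
  set t₂ : ℤ := 2 * p * d + p ^ 2 * b * c + p ^ 2 * d ^ 2 with ht₂
  have key₁ : (s₁ : ℂ) * L.ω₁ + (t₁ : ℂ) * L.ω₂ = 0 := by
    rw [hs₁, ht₁]; push_cast; linear_combination -c₁
  have key₂ : (s₂ : ℂ) * L.ω₁ + (t₂ : ℂ) * L.ω₂ = 0 := by
    rw [hs₂, ht₂]; push_cast; linear_combination -c₂
  have indep := LinearIndependent.pair_iff.mp L.indep
  have hz₁ := indep (s₁ : ℝ) (t₁ : ℝ) (by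
    rw [Complex.real_smul, Complex.real_smul, Complex.ofReal_intCast, Complex.ofReal_intCast]; exact key₁)
  have hz₂ := indep (s₂ : ℝ) (t₂ : ℝ) (by
    rw [Complex.real_smul, Complex.real_smul, Complex.ofReal_intCast, Complex.ofReal_intCast]; exact key₂)
  have Z1 : s₁ = 0 := by exact_mod_cast hz₁.1
  have Z2 : t₁ = 0 := by exact_mod_cast hz₁.2
  have Z3 : s₂ = 0 := by exact_mod_cast hz₂.1
  have Z4 : t₂ = 0 := by exact_mod_cast hz₂.2
  rw [hs₁] at Z1; rw [ht₁] at Z2; rw [hs₂] at Z3; rw [ht₂] at Z4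
  -- integer endgame
  have hp0 : (p : ℤ) ≠ 0 := by omega
  have hp2 : ¬ (p : ℤ) ∣ 2 := fun hd ↦ by
    have := Int.le_of_dvd (by norm_num) hd; omega
  have htr : (p : ℤ) * (a + d) + 2 ≠ 0 := fun h0 ↦ hp2 ⟨-(a + d), by linarith⟩
  have hb : b = 0 := by
    have hm : b * ((p : ℤ) * ((p : ℤ) * (a + d) + 2)) = 0 := by linear_combination Z2
    rcases mul_eq_zero.mp hm with h0 | h0
    · exact h0
    · rcases mul_eq_zero.mp h0 with h0 | h0
      · exact absurd h0 hp0
      · exact absurd h0 htr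
  have hc : c = 0 := by
    have hm : c * ((p : ℤ) * ((p : ℤ) * (a + d) + 2)) = 0 := by linear_combination Z3
    rcases mul_eq_zero.mp hm with h0 | h0
    · exact h0
    · rcases mul_eq_zero.mp h0 with h0 | h0
      · exact absurd h0 hp0
      · exact absurd h0 htr
  subst hb hc
  have ha : a = 0 := by
    have hm : a * ((p : ℤ) * ((p : ℤ) * a + 2)) = 0 := by linear_combination Z1
    rcases mul_eq_zero.mp hm with h0 | h0
    · exact h0
    · rcases mul_eq_zero.mp h0 with h0 | h0
      · exact absurd h0 hp0
      · exact absurd (⟨-a, by linarith⟩ : (p : ℤ) ∣ 2) hp2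
  have hd : d = 0 := by
    have hm : d * ((p : ℤ) * ((p : ℤ) * d + 2)) = 0 := by linear_combination Z4
    rcases mul_eq_zero.mp hm with h0 | h0
    · exact h0
    · rcases mul_eq_zero.mp h0 with h0 | h0
      · exact absurd h0 hp0
      · exact absurd (⟨-d, by linarith⟩ : (p : ℤ) ∣ 2) hp2
  subst ha hd
  -- now `ω₁`, `ω₂` are real: contradiction with independence
  have r₁ : conj L.ω₁ = L.ω₁ := by rw [e₁]; push_cast; ring
  have r₂ : conj L.ω₂ = L.ω₂ := by rw [e₂]; push_cast; ring
  have i₁ : L.ω₁.im = 0 := Complex.conj_eq_iff_im.mp r₁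
  have i₂ : L.ω₂.im = 0 := Complex.conj_eq_iff_im.mp r₂
  have hrel : (L.ω₂.re : ℝ) • L.ω₁ + (-L.ω₁.re : ℝ) • L.ω₂ = 0 := by
    rw [Complex.real_smul, Complex.real_smul]
    apply Complex.ext
    · simp only [Complex.add_re, Complex.re_ofReal_mul, Complex.zero_re]; ring
    · simp only [Complex.add_im, Complex.im_ofReal_mul, i₁, i₂, Complex.zero_im]; ring
  have h0 : L.ω₁.re = 0 := by linarith [(indep _ _ hrel).2]
  have hω₁ : L.ω₁ = 0 := Complex.ext (by simpa using h0) (by simpa using i₁)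
  exact L.indep.ne_zero 0 (by simpa using hω₁)

/-- **At `p = 2`: `z̄ − z ∈ 2Λ` for all `z ∈ Λ` makes `Λ` RECTANGULAR** — `re z ∈ Λ` and `i·im z ∈ Λ` for every `z ∈ Λ`
(`z̄ − z = −2i·im z`, so `i·im z ∈ Λ`, and `re z = z − i·im z`). [folklore] -/
theorem re_mem_and_im_mul_I_mem_of_conj_sub_self_mem_two_mul (Λ : Submodule ℤ ℂ)
    (h : ∀ z ∈ Λ, ∃ y ∈ Λ, conj z - z = 2 * y) {z : ℂ} (hz : z ∈ Λ) :
    (z.re : ℂ) ∈ Λ ∧ (z.im : ℂ) * Complex.I ∈ Λ := by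
  obtain ⟨y, hy, hyz⟩ := h z hz
  have hsub : z - conj z = 2 * ((z.im : ℂ) * Complex.I) := by
    rw [Complex.sub_conj]; push_cast; ring
  have hyI : (z.im : ℂ) * Complex.I = -y := by
    have : 2 * ((z.im : ℂ) * Complex.I) = 2 * (-y) := by rw [← hsub, mul_neg, ← hyz]; ring
    exact mul_left_cancel₀ two_ne_zero this
  have hI : (z.im : ℂ) * Complex.I ∈ Λ := by rw [hyI]; exact neg_mem hy
  refine ⟨?_, hI⟩
  have hre : (z.re : ℂ) = z - (z.im : ℂ) * Complex.I := by
    rw [eq_sub_iff_add_eq, Complex.re_add_im]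
  rw [hre]; exact sub_mem hz hI

/-! ## §2 Application to lattice-optimal `X₀(N)`-data -/

section Data

variable {W₀ : WeierstrassCurve ℚ} {N : ℕ} [NeZero N]

/-- **Transport to the Néron lattice**: for a lattice-optimal `X₀(N)`-datum (`Λ_{E₀} = c₀Λ₀(f)`) in the index-`p²` configuration
`Λ₁(f) = pΛ₀(f)`, every `z ∈ Λ_{E₀}` has `z̄ − z ∈ pΛ_{E₀}` (the newform has real coefficients; `conj_sub_self_mem_periodLatticeGamma1`). [cite: Stevens1989, §2] -/
theorem conj_sub_self_mem_natCast_mul_of_index (D₀ : ModularParametrizationData W₀ N)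
    (h₀ : ∀ z ∈ D₀.L.lattice, ∃ w ∈ periodLattice D₀.f, z = D₀.c * w) {p : ℕ}
    (hidx : ∀ z : ℂ, z ∈ periodLatticeGamma1 D₀.f ↔ ∃ w ∈ periodLattice D₀.f, z = (p : ℂ) * w) :
    ∀ z ∈ D₀.L.lattice, ∃ y ∈ D₀.L.lattice, conj z - z = (p : ℂ) * y := by
  intro z hz
  have hreal : ∀ n, (cuspCoeff D₀.f n).im = 0 := D₀.isNewformOf.1.cuspCoeff_im_eq_zero
  obtain ⟨w, hw, rfl⟩ := h₀ z hz
  obtain ⟨w', hw', hww'⟩ := (hidx _).mp (conj_sub_self_mem_periodLatticeGamma1 hreal hw)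
  refine ⟨D₀.c * w', D₀.smul_periodLattice_le w' hw', ?_⟩
  rw [map_mul, map_intCast, ← mul_sub, hww']; ring

/-- **The index-`p²` configuration `Λ₁(f) = pΛ₀(f)` never occurs for `p ≥ 3`** (any level `N`, any lattice-optimal `X₀(N)`-datum).
Unconditional; does not prove Manin's conjecture. [cite: Stevens1989, §2] [cite: Manin1972, §1.6] -/
theorem not_periodLatticeGamma1_eq_natCast_mul_periodLattice (D₀ : ModularParametrizationData W₀ N)
    (h₀ : ∀ z ∈ D₀.L.lattice, ∃ w ∈ periodLattice D₀.f, z = D₀.c * w) {p : ℕ} (hp : 3 ≤ p) :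
    ¬ (∀ z : ℂ, z ∈ periodLatticeGamma1 D₀.f ↔ ∃ w ∈ periodLattice D₀.f, z = (p : ℂ) * w) :=
  fun hidx ↦ false_of_conj_sub_self_mem_natCast_mul D₀.L hp (conj_sub_self_mem_natCast_mul_of_index D₀ h₀ hidx)

/-- **The index-`9` configuration `Λ₁(f) = 3Λ₀(f)` never occurs** — at every level `N`, for every lattice-optimal `X₀(N)`-datum.  This is
the hypothesis `hne9` of `…ManinOfStevensConjectures.maninPrimeToThreeAtNine_of_stevensConjectures`, previously a theorem only at `N = 9q`
(`not_periodLatticeGamma1_eq_three_mul_of_nine_mul`).  Unconditional; C3 itself stays OPEN. [cite: Stevens1989, §2] [cite: Manin1972, §1.6] -/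
theorem not_periodLatticeGamma1_eq_three_mul_periodLattice (D₀ : ModularParametrizationData W₀ N)
    (h₀ : ∀ z ∈ D₀.L.lattice, ∃ w ∈ periodLattice D₀.f, z = D₀.c * w) :
    ¬ (∀ z : ℂ, z ∈ periodLatticeGamma1 D₀.f ↔ ∃ w ∈ periodLattice D₀.f, z = 3 * w) := by
  have h := not_periodLatticeGamma1_eq_natCast_mul_periodLattice D₀ h₀ (p := 3) le_rfl
  exact_mod_cast h

/-- **At `p = 2`: the index-`4` configuration `Λ₁(f) = 2Λ₀(f)` forces a RECTANGULAR Néron lattice** — `re z ∈ Λ_{E₀}` and `i·im z ∈ Λ_{E₀}`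
for every `z ∈ Λ_{E₀}` (so `E₀(ℝ)` has two components and `E₀[2] ⊂ E₀(ℝ)`).  E-an-152b `ShimuraIndexNeFourAtFour` thus holds for every
optimal curve whose period lattice is not rectangular; the rectangular case stays OPEN. [cite: Stevens1989, §2] [cite: Manin1972, §1.6] -/
theorem re_mem_and_im_mul_I_mem_of_periodLatticeGamma1_eq_two_mul (D₀ : ModularParametrizationData W₀ N)
    (h₀ : ∀ z ∈ D₀.L.lattice, ∃ w ∈ periodLattice D₀.f, z = D₀.c * w)
    (hidx : ∀ z : ℂ, z ∈ periodLatticeGamma1 D₀.f ↔ ∃ w ∈ periodLattice D₀.f, z = 2 * w)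
    {z : ℂ} (hz : z ∈ D₀.L.lattice) : (z.re : ℂ) ∈ D₀.L.lattice ∧ (z.im : ℂ) * Complex.I ∈ D₀.L.lattice := by
  have hidx' : ∀ z : ℂ, z ∈ periodLatticeGamma1 D₀.f ↔ ∃ w ∈ periodLattice D₀.f, z = ((2 : ℕ) : ℂ) * w := by
    exact_mod_cast hidx
  have h := conj_sub_self_mem_natCast_mul_of_index D₀ h₀ hidx'
  exact re_mem_and_im_mul_I_mem_of_conj_sub_self_mem_two_mul D₀.L.lattice (by exact_mod_cast h) hz

/-- **Index `4` is excluded for non-rectangular Néron lattices**: if some `z ∈ Λ_{E₀}` has `re z ∉ Λ_{E₀}` (e.g. `Λ_{E₀}` rhombic,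
`Δ(E₀) < 0`), then `Λ₁(f) ≠ 2Λ₀(f)`. Unconditional; C2 stays OPEN. [cite: Stevens1989, §2] -/
theorem not_periodLatticeGamma1_eq_two_mul_of_re_notMem (D₀ : ModularParametrizationData W₀ N)
    (h₀ : ∀ z ∈ D₀.L.lattice, ∃ w ∈ periodLattice D₀.f, z = D₀.c * w)
    {z : ℂ} (hz : z ∈ D₀.L.lattice) (hre : (z.re : ℂ) ∉ D₀.L.lattice) :
    ¬ (∀ z : ℂ, z ∈ periodLatticeGamma1 D₀.f ↔ ∃ w ∈ periodLattice D₀.f, z = 2 * w) :=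
  fun hidx ↦ hre (re_mem_and_im_mul_I_mem_of_periodLatticeGamma1_eq_two_mul D₀ h₀ hidx hz).1

end Data

end Summit.BirchSwinnertonDyer.BirchSwinnertonDyer.Theorems.ManinLocalTwoThree

end
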